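import Mathlib.Analysis.SpecialFunctions.Pow.Real
import Mathlib.Analysis.SpecialFunctions.Log.Basic
import Mathlib.Analysis.Complex.ExponentialBounds
import HarnessLib

/-!
# `IntegerScrew.ScrewPolyFloor`, line `weil-comb-floor` — stub S6 `stub_endgameComb`

Crux `ScrewPolyFloor` (stmt-RiemannHypothesis-15757) of route IntegerScrew, line `weil-comb-floor`
(skeleton `Cruxes/ScrewPolyFloor/Lines/weil_comb_floor.lean`): the floor law under RH is obtained
from WeilComb's analytic reduction of the Weil form of a log-integer comb of tooth-width `ε`,
`y·S_M·y ≥ ε³ N/B · [log(1/ε) − C − (log M + 1) − 12 ε M²] ‖y‖²`, by the parameter choice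
`ε = M^{-K}`.  This file is that parameter choice, pure real analysis: given the absolute constant
`C` of the reduction and the two positive norms `N = ‖φ‖₂²`, `B = ‖φ'‖₁'²` of the bump, a natural
`K ≥ 4` with `(K − 1) log 2 ≥ C + 4 + log 2` gives `8 M^{1−K} ≤ 1`, `12 M^{2−K} ≤ 3` and a bracket
`≥ log 2`, so that `c M^{-A} ≤ M^{-K} (N/B) · bracket` with `A = K`, `c = (N/B) log 2`.

No analytic number theory enters; Mathlib only.
-/

-- the layout-mandated namespace `Summit.RiemannHypothesis.RiemannHypothesis.…` repeats the summit name
set_option linter.dupNamespace false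

namespace Summit.RiemannHypothesis.RiemannHypothesis.Theorems.IntegerScrewScrewPolyFloor

/-- Powers of a real `m ≥ 2` dominate: `m ^ j * 2 ^ i ≤ m ^ (j + i)`. -/
theorem pow_mul_two_pow_le {m : ℝ} (hm : 2 ≤ m) (j i : ℕ) : m ^ j * 2 ^ i ≤ m ^ (j + i) := by
  rw [pow_add]
  exact mul_le_mul_of_nonneg_left (pow_le_pow_left₀ (by norm_num) hm i) (by positivity)

/-- **Stub S6 `stub_endgameComb` of line `weil-comb-floor`** (parameter choice `ε = M^{-K}`):
for all real `C` and positive `N, B` there are `K : ℕ` and `A, c > 0` such that for every `M ≥ 2`,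
`8 M^{-K} M ≤ 1` and
`c M^{-A} ≤ M^{-K} N/B · (log(1/M^{-K}) − C − (log M + 1) − M^{-K} · 12 M²)`.
Take `K = max 4 (⌈(C+4)/log 2⌉₊ + 2)`, `A = K`, `c = (N/B) log 2`. -/
theorem stub_endgameComb : ∀ (C N B : ℝ), 0 < N → 0 < B → ∃ (K : ℕ) (A c : ℝ), 0 < c ∧ ∀ M : ℕ, 2 ≤ M →
    8 * ((M : ℝ) ^ K)⁻¹ * M ≤ 1 ∧
      c * (M : ℝ) ^ (-A) ≤
        ((M : ℝ) ^ K)⁻¹ * N / B *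
          (Real.log (1 / ((M : ℝ) ^ K)⁻¹) - C - (Real.log M + 1) -
            ((M : ℝ) ^ K)⁻¹ * (12 * (M : ℝ) ^ 2)) := by
  intro C N B hN hB
  have hlog2 : 0 < Real.log 2 := Real.log_pos one_lt_two
  -- the exponent
  set K : ℕ := max 4 (⌈(C + 4) / Real.log 2⌉₊ + 2) with hKdef
  have hK4 : 4 ≤ K := le_max_left _ _
  have hKC : (C + 4) / Real.log 2 + 2 ≤ (K : ℝ) := by
    have h1 : (C + 4) / Real.log 2 ≤ (⌈(C + 4) / Real.log 2⌉₊ : ℝ) := Nat.le_ceil _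
    have h2 : ((⌈(C + 4) / Real.log 2⌉₊ + 2 : ℕ) : ℝ) ≤ (K : ℝ) := by
      exact_mod_cast le_max_right 4 (⌈(C + 4) / Real.log 2⌉₊ + 2)
    push_cast at h2
    linarith
  have hKC' : C + 4 + Real.log 2 ≤ ((K : ℝ) - 1) * Real.log 2 := by
    have h := mul_le_mul_of_nonneg_right hKC hlog2.le
    rw [add_mul, div_mul_cancel₀ _ hlog2.ne'] at h
    linarith
  refine ⟨K, K, N / B * Real.log 2, by positivity, fun M hM => ?_⟩
  have hm : (2 : ℝ) ≤ (M : ℝ) := by exact_mod_cast hM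
  have hm0 : (0 : ℝ) < (M : ℝ) := by linarith
  have hmK : (0 : ℝ) < (M : ℝ) ^ K := by positivity
  -- `8 M ≤ M^K` and `4 M² ≤ M^K`
  obtain ⟨j, hj⟩ : ∃ j, K = 3 + j + 1 := ⟨K - 4, by omega⟩
  have h8 : 8 * (M : ℝ) ≤ (M : ℝ) ^ K := by
    have h := pow_mul_two_pow_le hm 1 3
    have h' : (M : ℝ) ^ (1 + 3) ≤ (M : ℝ) ^ K :=
      pow_le_pow_right₀ (by linarith) (by omega)
    rw [pow_one] at h
    linarith
  have h12 : 4 * (M : ℝ) ^ 2 ≤ (M : ℝ) ^ K := by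
    have h := pow_mul_two_pow_le hm 2 2
    have h' : (M : ℝ) ^ (2 + 2) ≤ (M : ℝ) ^ K :=
      pow_le_pow_right₀ (by linarith) (by omega)
    linarith
  constructor
  · -- `8 M^{-K} M ≤ 1`
    have e : 8 * ((M : ℝ) ^ K)⁻¹ * M = (8 * M) / (M : ℝ) ^ K := by ring
    rw [e, div_le_one hmK]
    exact h8
  · -- the floor inequality
    have hlogM : Real.log 2 ≤ Real.log M := Real.log_le_log two_pos hm
    have hlogpow : Real.log (1 / ((M : ℝ) ^ K)⁻¹) = K * Real.log M := by
      rw [one_div, inv_inv, Real.log_pow]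
    have hshadow : ((M : ℝ) ^ K)⁻¹ * (12 * (M : ℝ) ^ 2) ≤ 3 := by
      rw [inv_mul_le_iff₀ hmK]
      linarith
    have hbr : Real.log 2 ≤ Real.log (1 / ((M : ℝ) ^ K)⁻¹) - C - (Real.log M + 1) -
        ((M : ℝ) ^ K)⁻¹ * (12 * (M : ℝ) ^ 2) := by
      rw [hlogpow]
      have hK1 : (1 : ℝ) ≤ (K : ℝ) - 1 := by
        have : (4 : ℝ) ≤ K := by exact_mod_cast hK4
        linarith
      have h1 : ((K : ℝ) - 1) * Real.log 2 ≤ ((K : ℝ) - 1) * Real.log M :=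
        mul_le_mul_of_nonneg_left hlogM (by linarith)
      nlinarith
    have hpre : 0 ≤ ((M : ℝ) ^ K)⁻¹ * N / B := by positivity
    have hrpow : (M : ℝ) ^ (-(K : ℝ)) = ((M : ℝ) ^ K)⁻¹ := by
      rw [Real.rpow_neg hm0.le, Real.rpow_natCast]
    calc N / B * Real.log 2 * (M : ℝ) ^ (-(K : ℝ))
        = ((M : ℝ) ^ K)⁻¹ * N / B * Real.log 2 := by rw [hrpow]; ring
      _ ≤ ((M : ℝ) ^ K)⁻¹ * N / B *
          (Real.log (1 / ((M : ℝ) ^ K)⁻¹) - C - (Real.log M + 1) -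
            ((M : ℝ) ^ K)⁻¹ * (12 * (M : ℝ) ^ 2)) :=
          mul_le_mul_of_nonneg_left hbr hpre

end Summit.RiemannHypothesis.RiemannHypothesis.Theorems.IntegerScrewScrewPolyFloor
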